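import Literature.Topology.FourManifolds.SlideContext
import Literature.Topology.FourManifolds.MorseChartRotate
import Literature.Topology.FourManifolds.OneHandleStepMatch
import HarnessLib

/-!
# The flip context of a `1`-handle: two handle sides on one manifold, the second rotated

Topic `Literature/Topology/FourManifolds` (fact seat
`provefact-Literature.Topology.FourManifolds.lauden-f709dd520c`, Laudenbach–Poénaru's Lemma 2: the
flip `H₂`, "`Φ₂(x₁) = x₁⁻¹`", p. 339, realised by the self-diffeomorphism of the handlebody
exchanging the two feet of a `1`-handle).  Everything here is **proved**; no named facts.

A `SlideContext` (`SlideContext.lean`) is the one-sided data `S` of the handle-extension step of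
Milnor's Theorem 3.13 about the top critical point `p` of index `1`.  A **flip context** adds a
*second* handle side `S'` on the *same* manifold, with the *same* function, critical point and
constants, whose handle chart is the chart of `S` **rotated by `π`** in the `(u₀, y₁)`-plane
(`MorseChartRotate.rotateChart`): its `+` foot of parameter `w` is the `-` foot of `S` of
parameter `R₀ w` (`R₀ = modelReflection`), and whose field agrees with the field of `S` on the
seed collar.  The two-sided context `C.toCtx₂ : OneHandleStepContext n M M` (no shift, identity
seed) then satisfies the **matching condition** of the two-disc theorem (`toCtx₂_match`): the
identity seed preserves the canonical level orientations, and the lifted `+` foot of `S'` — the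
lifted `-` foot of `S` precomposed with the reflection `R₀` — has the character of the lifted `+`
foot of `S` (opposite characters of the two feet, `footLift_isOrientationPreserving_iff_neg_of_connected`,
and `isOrientationPreserving_comp_modelReflection`).  Hence the handle-extension machinery
produces a self-diffeomorphism of `M` which is the identity below the seed collar and the
rotation through the handle: the flip.

## References

* J. Milnor, *Lectures on the h-cobordism theorem* (1965), proof of Thm. 3.13 (PDF pp. 18–19).
  [MilnorHCobordism1965]
* F. Laudenbach, V. Poénaru, *A note on 4-dimensional handlebodies*, Bull. Soc. Math. France
  100 (1972) 337–344, proof of Lemma 2 (pp. 339–340). [LaudenbachPoenaruBSMF1972]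
* A. A. Kosinski, *Differential Manifolds* (1993), VI (6.4), (6.6). [Kosinski1993]
-/

open scoped Manifold ContDiff Topology
open Set Function Module Metric

noncomputable section

namespace Literature.Topology.FourManifolds

open BoundaryManifold MorseChartRotate

universe u

variable {n : ℕ} {M : Type u} [TopologicalSpace M] [ChartedSpace (EuclideanHalfSpace (n + 1)) M]
  [IsManifold (𝓡∂ (n + 1)) ∞ M]

variable (n M) in
/-- **The context of a flip**: a slide context `S, c, τ, …` about the top critical point `p`,
the Morse chart `φ` of `S` with a chart ball of radius `R₀ ≥ 5ε`, and a second handle side on the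
rotated chart — field `X'`, flow `θ'`, handle chart `D'` extending to `rotateChart φ p R₀` — with
the constants of `S` and `X' = X` on the seed collar `f⁻¹[c - 3τ, c + 5τ]`.
[cite: MilnorHCobordism1965, proof of Thm. 3.13 (PDF pp. 18–19)] -/
structure FlipContext extends SlideContext n M where
  /-- The Morse chart of `S`. -/
  φ : OpenPartialHomeomorph M (EuclideanHalfSpace (n + 1))
  /-- The radius of its chart ball. -/
  R₀ : ℝ
  hεR : 5 * S.ε ≤ R₀
  hballR : closedBall (φ.extend (𝓡∂ (n + 1)) S.p) R₀ ⊆ (φ.extend (𝓡∂ (n + 1))).target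
  hpφ : S.p ∈ φ.source
  hDe : ∀ q, S.D.chart.extend (𝓡∂ (n + 1)) q = φ.extend (𝓡∂ (n + 1)) q
  hDs : S.D.chart.source ⊆ φ.source
  /-- The field of the second side. -/
  X' : Π x : M, TangentSpace (𝓡∂ (n + 1)) x
  /-- Its flow. -/
  θ' : ℝ × M → M
  /-- The handle chart of the second side (on the rotated chart). -/
  D' : HandleChart (𝓡∂ (n + 1)) S.f X' S.p
  hX' : ContMDiff (𝓡∂ (n + 1)) (𝓡∂ (n + 1)).tangent ∞ fun x => (⟨x, X' x⟩ : TangentBundle (𝓡∂ (n + 1)) M)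
  flow' : IsSmoothFlow (𝓡∂ (n + 1)) X' θ'
  hk' : D'.k = 1
  hr' : D'.r = S.D.r
  hDe' : ∀ q, D'.chart.extend (𝓡∂ (n + 1)) q =
    (rotateChart (le_trans one_le_two hn) φ S.p R₀ hballR).extend (𝓡∂ (n + 1)) q
  hDs' : D'.chart.source ⊆ (rotateChart (le_trans one_le_two hn) φ S.p R₀ hballR).source
  hball' : closedBall (D'.chart.extend (𝓡∂ (n + 1)) S.p) (3 * S.ε) ⊆ (D'.chart.extend (𝓡∂ (n + 1))).target
  hunit' : ∀ x, S.f x ∈ Icc S.ℓ₁ S.ℓ₂ → x ∉ D'.core → mlineDeriv (𝓡∂ (n + 1)) S.f x (X' x) = 1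
  hspeed' : ∀ x, S.f x ∈ Icc S.ℓ₁ S.ℓ₂ → mlineDeriv (𝓡∂ (n + 1)) S.f x (X' x) ∈ Icc (0 : ℝ) 1
  isClosed_region' : IsClosed (D'.region S.ε S.γ (S.a - S.η / 4) S.ℓu)
  isClosed_region_half' : IsClosed (D'.region S.ε (S.γ / 2) (S.a - S.η / 4) S.ℓu)
  isClosed_region_small' : IsClosed (D'.region S.ε (S.γ / 2) S.a (S.ℓu - S.δ))
  core_subset' : D'.core ⊆ D'.region S.ε (S.γ / 2) (S.a - S.η / 4) S.ℓu
  lt_of_mem_core' : ∀ q ∈ D'.core, S.a - S.η / 4 < S.f q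
  hrel : ∀ x, S.f x ∈ Icc (c - 3 * τ) (c + 5 * τ) → X' x = S.X x

namespace FlipContext

variable (C : FlipContext n M)

/-- `1 ≤ n`. [folklore] -/
theorem hn1 (C : FlipContext n M) : 1 ≤ n := le_trans one_le_two C.hn

/-- The rotated chart of the context. [folklore] -/
abbrev φr : OpenPartialHomeomorph M (EuclideanHalfSpace (n + 1)) := rotateChart C.hn1 C.φ C.S.p C.R₀ C.hballR

/-- `0 < R₀`. [folklore] -/
theorem R₀_pos : 0 < C.R₀ := by linarith [C.hεR, C.S.ε_pos]

/-- **The second handle side**: same function, point and constants, the rotated chart.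
[cite: MilnorHCobordism1965, proof of Thm. 3.13 (PDF pp. 18–19)] -/
def S' : HandleSide (𝓡∂ (n + 1)) M where
  f := C.S.f
  X := C.X'
  θ := C.θ'
  p := C.S.p
  D := C.D'
  hf := C.S.hf
  hX := C.hX'
  flow := C.flow'
  ε := C.S.ε
  γ := C.S.γ
  η := C.S.η
  a := C.S.a
  ℓ₁ := C.S.ℓ₁
  ℓ₂ := C.S.ℓ₂
  ℓu := C.S.ℓu
  δ := C.S.δ
  ε_pos := C.S.ε_pos
  γ_pos := C.S.γ_pos
  η_pos := C.S.η_pos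
  δ_pos := C.S.δ_pos
  hball := C.hball'
  hunit := C.hunit'
  hspeed := C.hspeed'
  isClosed_region := C.isClosed_region'
  isClosed_region_half := C.isClosed_region_half'
  isClosed_region_small := C.isClosed_region_small'
  core_subset := C.core_subset'
  lt_of_mem_core := C.lt_of_mem_core'
  hlow := C.S.hlow
  hhigh := C.S.hhigh
  hℓ₁ := C.S.hℓ₁
  ha := C.S.ha
  hℓu := C.S.hℓu

/-- **The two-sided context of a flip**: sides `S`, `S'`, no shift, identity seed.
[cite: MilnorHCobordism1965, proof of Thm. 3.13 (PDF pp. 18–19)] -/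
def toCtx₂ : OneHandleStepContext n M M where
  S := C.S
  S' := C.S'
  hn := C.hn
  hF := C.hF
  hF' := C.hF
  σ := 0
  c := C.c
  τ := C.τ
  τ_pos := C.τ_pos
  hk := C.hk
  hk' := C.hk'
  hr := C.hr'
  hε := rfl
  hγ := rfl
  hη := rfl
  hδ := rfl
  ha := (add_zero _).symm
  hℓ₁ := (add_zero _).symm
  hℓ₂ := (add_zero _).symm
  hℓu := (add_zero _).symm
  hfp := (add_zero _).symm
  hr_eq := C.hr_eq
  hγ_eq := C.hγ_eq
  ha_eq := C.ha_eq
  hℓu_eq := C.hℓu_eq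
  hδ_eq := C.hδ_eq
  hℓ₁_eq := C.hℓ₁_eq
  hℓ₂_eq := C.hℓ₂_eq
  hε1 := C.hε1
  hτε := C.hτε
  hηε := C.hηε
  hητ := C.hητ
  hcτ := C.hcτ
  htop := C.htop
  htop' := C.htop
  hreg := C.hreg
  hreg' := fun y hy hyp => C.hreg y (by have : C.S'.f y = C.S.f y := rfl; linarith) hyp
  g₀ := id
  g₀' := id
  hg₀ := fun _ _ => contMDiffAt_id
  hg₀' := fun _ _ => contMDiffAt_id
  hlev₀ := fun _ _ => (add_zero _).symm
  hlev₀' := fun _ _ => (sub_zero _).symm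
  hinv₀ := fun _ _ => rfl
  hinv₀' := fun _ _ => rfl
  hrel₀ := fun x hx => by
    show mfderiv (𝓡∂ (n + 1)) (𝓡∂ (n + 1)) id x (C.S.X x) = C.X' x
    rw [mfderiv_id, C.hrel x ⟨by linarith [hx.1, C.τ_pos], by linarith [hx.2, C.τ_pos]⟩]; rfl
  hconn := C.hconn
  oM := C.oM
  oM' := C.oM

/-! ### Definitional unfoldings -/

/-- The first side. [folklore] -/
@[simp] theorem toCtx₂_S : C.toCtx₂.S = C.S := rfl
/-- The second side. [folklore] -/
@[simp] theorem toCtx₂_S' : C.toCtx₂.S' = C.S' := rfl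
/-- No level shift. [folklore] -/
@[simp] theorem toCtx₂_σ : C.toCtx₂.σ = 0 := rfl
/-- The seed level. [folklore] -/
@[simp] theorem toCtx₂_c : C.toCtx₂.c = C.c := rfl
/-- The seed width. [folklore] -/
@[simp] theorem toCtx₂_τ : C.toCtx₂.τ = C.τ := rfl
/-- The seed is the identity. [folklore] -/
@[simp] theorem toCtx₂_g₀ : C.toCtx₂.g₀ = id := rfl
/-- The inverse seed is the identity. [folklore] -/
@[simp] theorem toCtx₂_g₀' : C.toCtx₂.g₀' = id := rfl
/-- The function of the second side. [folklore] -/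
@[simp] theorem S'_f : C.S'.f = C.S.f := rfl
/-- The point of the second side. [folklore] -/
@[simp] theorem S'_p : C.S'.p = C.S.p := rfl
/-- The chart of the second side. [folklore] -/
@[simp] theorem S'_D : C.S'.D = C.D' := rfl
/-- The field of the second side. [folklore] -/
@[simp] theorem S'_X : C.S'.X = C.X' := rfl
/-- The flow of the second side. [folklore] -/
@[simp] theorem S'_θ : C.S'.θ = C.θ' := rfl
/-- The two depths coincide. [folklore] -/
theorem toCtx₂_m' : C.toCtx₂.m' = C.toCtx₂.m := rfl

/-- The level map of the identity seed is the identity on points. [folklore] -/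
theorem toCtx₂_Ψlev_apply (v : C.toCtx₂.Sl.Level C.toCtx₂.c) :
    ((C.toCtx₂.Ψlev v : C.toCtx₂.Sl'.Level (C.toCtx₂.c + C.toCtx₂.σ)) : M) = (v : M) := rfl

/-! ### The centres and feet of the two charts -/

/-- The centre of the chart of `S` is the centre of `φ`. [folklore] -/
theorem extend_p : C.S.D.chart.extend (𝓡∂ (n + 1)) C.S.p = C.φ.extend (𝓡∂ (n + 1)) C.S.p := C.hDe _

/-- The centre of the chart of `S'` is the centre of `φ`. [folklore] -/
theorem extend_p' : C.D'.chart.extend (𝓡∂ (n + 1)) C.S.p = C.φ.extend (𝓡∂ (n + 1)) C.S.p := by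
  rw [C.hDe', extend_rotateChart_self C.hn1 C.φ C.S.p C.R₀ C.hballR C.hpφ C.R₀_pos]

/-- **The feet of the second side are the feet of the first with the sign exchanged and the
parameter reflected**, for the depth `m` and radius `ρ` of the context and `‖w‖` arbitrary with
the foot in the chart ball of radius `ε`. [cite: Kosinski1993, VI (6.6)] -/
theorem foot'_eq {s : ℝ} (hs : s ^ 2 = 1) (w : EuclideanSpace ℝ (Fin n)) :
    C.D'.foot s C.toCtx₂.m C.toCtx₂.ρ w = C.S.D.foot (-s) C.toCtx₂.m C.toCtx₂.ρ (modelReflection C.hn1 w) := by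
  have hε := C.S.ε_pos
  have hm : 0 ≤ C.toCtx₂.m := by rw [C.toCtx₂.m_eq]; positivity
  have hs' : (-s) ^ 2 = 1 := by rw [neg_sq, hs]
  have hn₁ : ‖footModel n s C.toCtx₂.m C.toCtx₂.ρ w‖ < C.S.ε :=
    norm_footModel_lt hs hm C.toCtx₂.ρ_pos hε C.toCtx₂.hmR w
  have hn₂ : ‖footModel n (-s) C.toCtx₂.m C.toCtx₂.ρ (modelReflection C.hn1 w)‖ < C.S.ε :=
    norm_footModel_lt hs' hm C.toCtx₂.ρ_pos hε C.toCtx₂.hmR _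
  have hb : ∀ {u : EuclideanSpace ℝ (Fin (n + 1))}, ‖u‖ < C.S.ε →
      C.φ.extend (𝓡∂ (n + 1)) C.S.p + u ∈ ball (C.φ.extend (𝓡∂ (n + 1)) C.S.p) C.R₀ := fun {u} hu => by
    rw [mem_ball, dist_eq_norm, add_sub_cancel_left]; linarith [C.hεR]
  have hcb : ∀ {u : EuclideanSpace ℝ (Fin (n + 1))}, ‖u‖ < C.S.ε →
      C.φ.extend (𝓡∂ (n + 1)) C.S.p + u ∈ closedBall (C.φ.extend (𝓡∂ (n + 1)) C.S.p) (3 * C.S.ε) := fun {u} hu => by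
    rw [mem_closedBall, dist_eq_norm, add_sub_cancel_left]; linarith
  refine foot_eq_foot_neg C.hn1 C.φ C.S.p C.R₀ C.hballR C.D' C.S.D C.hDe' C.hDs' C.hDe C.hDs C.hpφ C.R₀_pos
    (hb hn₁) (hb hn₂) ?_ ?_
  · have h := C.hball'; rw [C.extend_p'] at h; exact h (hcb hn₁)
  · have h := C.S.hball; rw [C.extend_p] at h; exact h (hcb hn₂)

/-- **The lifted `+` foot of `S'` is the lifted `-` foot of `S` precomposed with the
reflection.** [cite: Kosinski1993, VI (6.6)] -/
theorem footLift'_eq :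
    C.toCtx₂.T'.footLift C.toCtx₂.ρ_pos C.toCtx₂.hmR' (one_pow 2) =
      C.toCtx₂.T.footLift C.toCtx₂.ρ_pos C.toCtx₂.hmR neg_one_sq ∘ modelReflection C.hn1 := by
  funext w
  apply Subtype.ext; apply Subtype.ext
  show C.D'.foot 1 C.toCtx₂.m' C.toCtx₂.ρ w = C.S.D.foot (-1) C.toCtx₂.m C.toCtx₂.ρ (modelReflection C.hn1 w)
  rw [C.toCtx₂_m']
  exact C.foot'_eq (one_pow 2) w

/-! ### The matching condition -/

/-- **The identity level map preserves the canonical level orientations** (one slab, two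
level parameters that are equal). [cite: HirschDT1976, §4.4 p. 101] -/
theorem _root_.Literature.Topology.FourManifolds.UnitSlab.isOrientationPreserving_levelDiffeomorphOfMaps_id
    (S : UnitSlab (n := n) M) {ℓ ℓ' : ℝ}
    {hint : ∀ p, S.f p ≤ ℓ → (𝓡∂ (n + 1)).IsInteriorPoint p} {hreg : ∀ p, S.f p = ℓ → ¬ IsMCriticalPt (𝓡∂ (n + 1)) S.f p}
    {hint' : ∀ p, S.f p ≤ ℓ' → (𝓡∂ (n + 1)).IsInteriorPoint p} {hreg' : ∀ p, S.f p = ℓ' → ¬ IsMCriticalPt (𝓡∂ (n + 1)) S.f p}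
    [csW : ChartedSpace (EuclideanHalfSpace (n + 1)) ↥(S.f ⁻¹' Iic ℓ)] [mfd : IsManifold (𝓡∂ (n + 1)) ∞ ↥(S.f ⁻¹' Iic ℓ)]
    [csW' : ChartedSpace (EuclideanHalfSpace (n + 1)) ↥(S.f ⁻¹' Iic ℓ')] [mfd' : IsManifold (𝓡∂ (n + 1)) ∞ ↥(S.f ⁻¹' Iic ℓ')]
    (hcs : csW = (sublevelAtlas S.hf ℓ hint hreg).chartedSpace) (hcs' : csW' = (sublevelAtlas S.hf ℓ' hint' hreg').chartedSpace)
    (e : ℓ' = ℓ) (hlev : ∀ x, S.f x = ℓ → S.f (id x) = ℓ') (hlev' : ∀ y, S.f y = ℓ' → S.f (id y) = ℓ) (hn : 1 ≤ n)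
    (hg : ∀ x, S.f x = ℓ → ContMDiffAt (𝓡∂ (n + 1)) (𝓡∂ (n + 1)) ∞ id x)
    (hg' : ∀ y, S.f y = ℓ' → ContMDiffAt (𝓡∂ (n + 1)) (𝓡∂ (n + 1)) ∞ id y)
    (hinv : ∀ x, S.f x = ℓ → id (id x) = x) (hinv' : ∀ y, S.f y = ℓ' → id (id y) = y)
    (oM : SmoothOrientation (𝓡∂ (n + 1)) M) :
    (levelDiffeomorphOfMaps S S hcs hcs' (g := id) (g' := id) hlev hlev' hn hg hg' hinv hinv').IsOrientationPreserving
      (S.levelOrientation hcs oM hn) (S.levelOrientation hcs' oM hn) := by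
  subst e
  subst hcs
  subst hcs'
  exact isOrientationPreserving_id _

/-- **The identity seed preserves the canonical level orientations.** [cite: HirschDT1976, §4.4 p. 101] -/
theorem toCtx₂_seedPres : C.toCtx₂.SeedPres :=
  ⟨C.toCtx₂.Sl.isOrientationPreserving_levelDiffeomorphOfMaps_id (csW := C.toCtx₂.instCsC) (mfd := C.toCtx₂.instMfdC)
    (csW' := C.toCtx₂.instCsC') (mfd' := C.toCtx₂.instMfdC') rfl rfl (add_zero _)
    (fun x hx => by have hx' : C.S.f x = C.c := hx; show C.S.f x = C.c + 0; rw [add_zero]; exact hx')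
    (fun y hy => by have hy' : C.S.f y = C.c + 0 := hy; show C.S.f y = C.c; rw [hy', add_zero])
    C.toCtx₂.hn1 (fun _ _ => contMDiffAt_id) (fun _ _ => contMDiffAt_id) (fun _ _ => rfl) (fun _ _ => rfl) C.oM⟩

/-- **The lifted `+` feet of the two sides have the same character.** [cite: Kosinski1993, VI (6.6)] -/
theorem toCtx₂_footChar_iff (o₀ : Orientation ℝ (EuclideanSpace ℝ (Fin n)) (Fin (finrank ℝ (EuclideanSpace ℝ (Fin n))))) :
    C.toCtx₂.FootChar o₀ ↔ C.toCtx₂.FootChar' o₀ := by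
  rw [C.toCtx₂.footChar_iff, C.toCtx₂.footChar'_iff, C.footLift'_eq]
  have hR := modelReflection C.hn1
  -- the `-` foot of `S` composed with the reflection has the character of the `+` foot
  have hoct := C.toCtx₂.T.footLift_isOrientationPreserving_iff_neg_of_connected C.oM C.toCtx₂.oFoot C.toCtx₂.ρ_pos C.toCtx₂.hmR
  have hemb := C.toCtx₂.T.isSmoothEmbedding_footLift C.toCtx₂.ρ_pos C.toCtx₂.hmR neg_one_sq
  have hopen := C.toCtx₂.isOpen_range_footLift neg_one_sq
  have hemb' : Manifold.IsSmoothEmbedding 𝓘(ℝ, EuclideanSpace ℝ (Fin n)) (𝓡 n) ∞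
      (C.toCtx₂.T.footLift C.toCtx₂.ρ_pos C.toCtx₂.hmR neg_one_sq ∘ modelReflection C.hn1) :=
    hemb.comp_openPartialHomeomorph (modelReflection C.hn1).toContinuousLinearEquiv.toHomeomorph.toOpenPartialHomeomorph
      (by simp) (modelReflection C.hn1).toContinuousLinearEquiv.contDiff.contMDiff.contMDiffOn
      (modelReflection C.hn1).symm.toContinuousLinearEquiv.contDiff.contMDiff.contMDiffOn
  have hopen' : IsOpen (range (C.toCtx₂.T.footLift C.toCtx₂.ρ_pos C.toCtx₂.hmR neg_one_sq ∘ modelReflection C.hn1)) := by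
    rw [(modelReflection C.hn1).surjective.range_comp]; exact hopen
  constructor
  · intro h
    exact OneHandleStepContext.isOrientationPreserving_comp_modelReflection C.hn1 hemb hopen ((hoct o₀).1 h)
  · intro h
    have h' : IsOrientationPreserving (SmoothOrientation.modelSpace (-(-o₀))) C.toCtx₂.oFoot
        (C.toCtx₂.T.footLift C.toCtx₂.ρ_pos C.toCtx₂.hmR neg_one_sq ∘ modelReflection C.hn1) := by
      rw [neg_neg o₀]; exact h
    have h2 := OneHandleStepContext.isOrientationPreserving_comp_modelReflection C.hn1 hemb' hopen' h'
    have hRR : (C.toCtx₂.T.footLift C.toCtx₂.ρ_pos C.toCtx₂.hmR neg_one_sq ∘ modelReflection C.hn1) ∘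
        modelReflection C.hn1 = C.toCtx₂.T.footLift C.toCtx₂.ρ_pos C.toCtx₂.hmR neg_one_sq := by
      funext w; simp [modelReflection_modelReflection]
    rw [hRR] at h2
    exact (hoct o₀).2 h2

/-- **The matching condition holds for a flip context.** [cite: Kosinski1993, VI (6.6)] -/
theorem toCtx₂_match : C.toCtx₂.Match :=
  C.toCtx₂.match_of_decision ((stdOrthonormalBasis ℝ (EuclideanSpace ℝ (Fin n))).toBasis.orientation)
    (iff_of_true C.toCtx₂_seedPres (C.toCtx₂_footChar_iff _))

end FlipContext

end Literature.Topology.FourManifolds
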